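import Literature.Probability.RandomPlanarGeometry.HexSAWHexagonSurgery
import Literature.Probability.RandomPlanarGeometry.HexSAWBrickWallWalks
import HarnessLib

/-!
# Hexagon surgery restricted to bridges of the honeycomb lattice («HEX-BRIDGE-RATIO-2», crux K76 — the base)

Topic `Literature/Probability/RandomPlanarGeometry` (lane «pcv-sawmu», route R76 «HEX-BRIDGE-RATIO-2(-RATE)»: the
two-step ratio limit `b_{N+2}(ℍ)/b_N(ℍ) → 2 + √2` for BRIDGES of the honeycomb lattice). Sources: N. Madras, G. Slade,
*The Self-Avoiding Walk* (1993), Definition 1.2.4 (bridges), §7.3, proof of Theorem 7.3.2 pp. 244–245 (the pattern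
pair `U`/`V`, the pairs `(ω, insertion site)` counted in two ways, (7.3.5)–(7.3.6)) and Theorem 7.3.4(d) p. 248 (the
bridge ratio theorem on `ℤ^d`); G. Grimmett, *Probability on Graphs* (2nd ed. 2018), §5.5 (brick-wall form of `ℍ`).

This file restricts the tree's hexagon surgery `HV.hexIns` / `HV.hexDel` of `HexSAWHexagonSurgery.lean` (a-p5, H-BASE:
`U` = two consecutive edges of a hexagon replaced by the other four) to BRIDGES. Heights are the brick-wall abscissa
`ht v = v.1 − v.2.1 = (hvToBW v) 0`; the list-model bridges `bridgeFin N ⊆ sawFin hvOrigin N` are transported to the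
brick-wall bridges `HexBW.bridges N` of `HexSAWBrickWallWalks.lean` (a-p6), `#(bridgeFin N) = b_N(ℍ)`. Admissible
insertion slots `bSlots` are the hexagon slots whose three new vertices lie in the band `(0, ht ω_N]`; admissible
deletion sites `bSharp` are the deletion sites whose new vertex lies in the band (a deletion at position `0` through the
vertical neighbour of the base vertex would put height `0` at time `1` — this is the only obstruction, see
`HexSAWBrickWallBridgeBookkeeping.lean`). With both windows, insertion/deletion map bridges to bridges and the
pair bijection of H-BASE restricts exactly. Status in print: Kesten's surgery is printed for walks of `ℤ^d`; its restriction
to bridges is implicit in M–S Theorem 7.3.4 and never written for `ℍ`; first written and kernel-checked here, no novelty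
claimed beyond the band bookkeeping.

## Contents (namespace `Literature.Probability.RandomPlanarGeometry.SAW.HV`; all PROVED, axioms standard)

* heights `ht`, `ht_le_of_adj`, uniqueness of the neighbour at level offset `+1 / −1 / 0`
  (`eq_of_adj_of_ht_eq_add_one`, `eq_of_adj_of_ht_add_one_eq`, `eq_of_adj_of_ht_eq`);
* `htAt`, `IsBridgeL`, **`bridgeFin`**, `toBW` and **`card_bridgeFin : #(bridgeFin N) = HexBW.bridgeCount N`**;
* `top`, `InBand`, **`bSlots`**, **`bSharp`** with `mem_bSlots`, `mem_bSharp`, `card_bSlots_le`, `card_bSharp_le`;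
* laws `top_hexIns`, `top_hexDel`, **`hexIns_mem_bridgeFin`**, **`hexDel_mem_bridgeFin`**, `mem_bSharp_hexIns`,
  `mem_bSlots_hexDel`; pairs `bSlotPairs`, `bSharpPairs`, `sum_bSlotPairs`, `sum_bSharpPairs`,
  **`sum_bSlotPairs_eq_sum_bSharpPairs`**.
-/

noncomputable section

open Finset Literature.Probability.LatticeModels SimpleGraph
open scoped BigOperators

namespace Literature.Probability.RandomPlanarGeometry.SAW.HV

/-! ### Heights: the brick-wall abscissa of a honeycomb vertex -/

/-- The height of a vertex of `ℍ`: the abscissa `v.1 − v.2.1` of its brick-wall image `hvToBW v`.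
[cite: EntingJensen2009, §7.4.2, Fig. 7.10 (brick-wall form of the hexagonal lattice)] -/
def ht (v : HV) : ℤ := v.1 - v.2.1

/-- `ht v` is coordinate `0` of `hvToBW v`. [cite: EntingJensen2009, §7.4.2, Fig. 7.10 (brick-wall form of the hexagonal lattice)] -/
theorem ht_eq_hvToBW (v : HV) : ht v = hvToBW v 0 := by
  rw [hvToBW_apply_zero]; rfl

/-- The base vertex has height `0`. [cite: EntingJensen2009, §7.4.2, Fig. 7.10 (brick-wall form of the hexagonal lattice)] -/
@[simp] theorem ht_hvOrigin : ht hvOrigin = 0 := by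
  simp [ht, hvOrigin]

/-- A step of `ℍ` changes the height by at most `1`. [cite: EntingJensen2009, §7.4.2, Fig. 7.10 (brick-wall form of the hexagonal lattice)] -/
theorem ht_le_of_adj {u v : HV} (h : hvGraph.Adj u v) : ht v ≤ ht u + 1 ∧ ht u ≤ ht v + 1 := by
  obtain ⟨a, b, c⟩ := u
  obtain ⟨a', b', c'⟩ := v
  rw [hvGraph_adj] at h
  cases c <;> cases c' <;> simp [HV.AdjRel, ht] at h ⊢ <;> omega

/-- A vertex of `ℍ` has exactly one neighbour one level up. [cite: EntingJensen2009, §7.4.2, Fig. 7.10 (brick-wall form of the hexagonal lattice)] -/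
theorem eq_of_adj_of_ht_eq_add_one {u v w : HV} (hv : hvGraph.Adj u v) (hw : hvGraph.Adj u w)
    (h1 : ht v = ht u + 1) (h2 : ht w = ht u + 1) : v = w := by
  obtain ⟨a, b, c⟩ := u
  obtain ⟨a', b', c'⟩ := v
  obtain ⟨a'', b'', c''⟩ := w
  rw [hvGraph_adj] at hv hw
  cases c <;> cases c' <;> cases c'' <;> simp [HV.AdjRel, ht, Prod.ext_iff] at hv hw h1 h2 ⊢ <;> omega

/-- A vertex of `ℍ` has exactly one neighbour one level down. [cite: EntingJensen2009, §7.4.2, Fig. 7.10 (brick-wall form of the hexagonal lattice)] -/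
theorem eq_of_adj_of_ht_add_one_eq {u v w : HV} (hv : hvGraph.Adj u v) (hw : hvGraph.Adj u w)
    (h1 : ht v + 1 = ht u) (h2 : ht w + 1 = ht u) : v = w := by
  obtain ⟨a, b, c⟩ := u
  obtain ⟨a', b', c'⟩ := v
  obtain ⟨a'', b'', c''⟩ := w
  rw [hvGraph_adj] at hv hw
  cases c <;> cases c' <;> cases c'' <;> simp [HV.AdjRel, ht, Prod.ext_iff] at hv hw h1 h2 ⊢ <;> omega

/-- A vertex of `ℍ` has exactly one neighbour on its own level. [cite: EntingJensen2009, §7.4.2, Fig. 7.10 (brick-wall form of the hexagonal lattice)] -/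
theorem eq_of_adj_of_ht_eq {u v w : HV} (hv : hvGraph.Adj u v) (hw : hvGraph.Adj u w)
    (h1 : ht v = ht u) (h2 : ht w = ht u) : v = w := by
  obtain ⟨a, b, c⟩ := u
  obtain ⟨a', b', c'⟩ := v
  obtain ⟨a'', b'', c''⟩ := w
  rw [hvGraph_adj] at hv hw
  cases c <;> cases c' <;> cases c'' <;> simp [HV.AdjRel, ht, Prod.ext_iff] at hv hw h1 h2 ⊢ <;> omega

/-! ### Bridges of `ℍ` in the list model -/

/-- The height of the `i`-th vertex of a list. [cite: MadrasSlade1993, Definition 1.2.4] -/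
def htAt (ω : List HV) (i : ℕ) : ℤ := ht (ω.getD i hvOrigin)

/-- **Bridge** (Madras–Slade Definition 1.2.4, height = brick-wall abscissa): `ht ω₀ < ht ωᵢ ≤ ht ω_N` for
`1 ≤ i ≤ N`. [cite: MadrasSlade1993, Definition 1.2.4] -/
def IsBridgeL (N : ℕ) (ω : List HV) : Prop :=
  ∀ i, 1 ≤ i → i ≤ N → htAt ω 0 < htAt ω i ∧ htAt ω i ≤ htAt ω N

open Classical in
/-- The `N`-step bridges of `ℍ` from the base vertex, in the list model of `HexSAWHexagonSurgery`.
[cite: MadrasSlade1993, Definition 1.2.4] -/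
def bridgeFin (N : ℕ) : Finset (List HV) := (sawFin hvOrigin N).filter (IsBridgeL N)

/-- Membership in `bridgeFin`. [cite: MadrasSlade1993, Definition 1.2.4] -/
theorem mem_bridgeFin {N : ℕ} {ω : List HV} : ω ∈ bridgeFin N ↔ ω ∈ sawFin hvOrigin N ∧ IsBridgeL N ω := by
  classical
  exact Finset.mem_filter

/-- `bridgeFin N ⊆ sawFin hvOrigin N`. [cite: MadrasSlade1993, Definition 1.2.4] -/
theorem bridgeFin_subset (N : ℕ) : bridgeFin N ⊆ sawFin hvOrigin N := fun _ h => (mem_bridgeFin.1 h).1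

/-! ### Transport to the brick-wall vertex functions: `#(bridgeFin N) = b_N(ℍ)` -/

/-- `hvToBW hvOrigin = 0`. [cite: EntingJensen2009, §7.4.2, Fig. 7.10 (brick-wall form of the hexagonal lattice)] -/
theorem hvToBW_hvOrigin : hvToBW hvOrigin = 0 := by
  rw [← bwToHV_zero, hvToBW_bwToHV]

/-- `bwIso.symm` is `hvToBW` on vertices. [cite: EntingJensen2009, §7.4.2, Fig. 7.10 (brick-wall form of the hexagonal lattice)] -/
theorem bwIso_symm_apply (v : HV) : bwIso.symm v = hvToBW v := rfl

/-- An `ℍ`-list read as a brick-wall vertex function frozen after time `N`.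
[cite: MadrasSlade1993, §1.1] -/
def toBW (N : ℕ) (ω : List HV) : ℕ → Site 2 := HexBW.ofList N (ω.map hvToBW)

/-- Values of `toBW`. [cite: MadrasSlade1993, §1.1] -/
theorem toBW_apply (N : ℕ) (ω : List HV) (i : ℕ) : toBW N ω i = hvToBW (ω.getD (min i N) hvOrigin) := by
  simp only [toBW, HexBW.ofList]
  rw [← hvToBW_hvOrigin, List.getD_map]

/-- Heights are transported: coordinate `0` of `toBW N ω i` is `htAt ω i`. [cite: MadrasSlade1993, §1.1] -/
theorem toBW_apply_zero {N : ℕ} (ω : List HV) {i : ℕ} (hi : i ≤ N) : toBW N ω i 0 = htAt ω i := by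
  rw [toBW_apply, min_eq_left hi, hvToBW_apply_zero]
  rfl

/-- The brick-wall list of an `ℍ`-walk is a brick-wall walk. [cite: MadrasSlade1993, §1.1] -/
theorem map_hvToBW_mem_sawLists {N : ℕ} {ω : List HV} (hω : ω ∈ sawFin hvOrigin N) :
    ω.map hvToBW ∈ sawLists brickWallGraph (0 : Site 2) N := by
  have h := (map_mem_sawLists_iff bwIso.symm (v := hvOrigin) (n := N) (l := ω)).2 (mem_sawFin_iff.1 hω)
  have e : (⇑bwIso.symm : HV → Site 2) = hvToBW := funext bwIso_symm_apply
  rwa [e, hvToBW_hvOrigin] at h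

/-- `toBW N` is injective on `sawFin hvOrigin N`. [cite: MadrasSlade1993, §1.1] -/
theorem toBW_injOn (N : ℕ) : Set.InjOn (toBW N) ↑(sawFin hvOrigin N) := by
  intro ω hω ω' hω' h
  have h1 := HexBW.ofList_injOn N (map_hvToBW_mem_sawLists hω) (map_hvToBW_mem_sawLists hω') h
  exact (List.map_injective_iff.2 bwEquiv.symm.injective) h1

/-- `toBW N ω` is a brick-wall walk. [cite: MadrasSlade1993, §1.1] -/
theorem toBW_mem_saws {N : ℕ} {ω : List HV} (hω : ω ∈ sawFin hvOrigin N) : toBW N ω ∈ HexBW.saws N := by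
  have : toBW N ω ∈ HexBW.ofList N '' sawLists brickWallGraph (0 : Site 2) N :=
    ⟨ω.map hvToBW, map_hvToBW_mem_sawLists hω, rfl⟩
  rw [HexBW.ofList_image] at this
  exact Finset.mem_coe.1 this

/-- Bridge-ness is transported. [cite: MadrasSlade1993, Definition 1.2.4] -/
theorem isBridge_toBW_iff {N : ℕ} (ω : List HV) : Zd.IsBridge N (toBW N ω) ↔ IsBridgeL N ω := by
  simp only [Zd.IsBridge, IsBridgeL]
  refine forall_congr' fun i => forall_congr' fun h1 => forall_congr' fun h2 => ?_
  rw [toBW_apply_zero ω (Nat.zero_le N), toBW_apply_zero ω h2, toBW_apply_zero ω le_rfl]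

open Classical in
/-- The image of `bridgeFin N` under `toBW N` is `HexBW.bridges N`. [cite: MadrasSlade1993, Definition 1.2.4] -/
theorem image_toBW_bridgeFin (N : ℕ) : (bridgeFin N).image (toBW N) = HexBW.bridges N := by
  ext f
  rw [Finset.mem_image, HexBW.mem_bridges]
  simp only [mem_bridgeFin]
  constructor
  · rintro ⟨ω, ⟨hω, hb⟩, rfl⟩
    exact ⟨toBW_mem_saws hω, (isBridge_toBW_iff ω).2 hb⟩
  · rintro ⟨hf, hb⟩
    have hf' : f ∈ HexBW.ofList N '' sawLists brickWallGraph (0 : Site 2) N := by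
      rw [HexBW.ofList_image]; exact Finset.mem_coe.2 hf
    obtain ⟨l, hl, rfl⟩ := hf'
    set ω : List HV := l.map bwToHV with hωdef
    have hωl : ω.map hvToBW = l := by
      rw [hωdef, List.map_map]
      convert List.map_id l
      funext x
      exact hvToBW_bwToHV x
    have hω : ω ∈ sawFin hvOrigin N := by
      rw [mem_sawFin_iff]
      have h := (map_mem_sawLists_iff bwIso (v := (0 : Site 2)) (n := N) (l := l)).2 hl
      have e : (⇑bwIso : Site 2 → HV) = bwToHV := funext bwIso_apply
      rwa [e, bwToHV_zero] at h
    have htoBW : toBW N ω = HexBW.ofList N l := by rw [toBW, hωl]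
    exact ⟨ω, ⟨hω, (isBridge_toBW_iff ω).1 (htoBW ▸ hb)⟩, htoBW⟩

open Classical in
/-- **`#(bridgeFin N) = b_N(ℍ)`**: the list-model bridges of `ℍ` are in bijection with the brick-wall
bridges `HexBW.bridges N`. [cite: MadrasSlade1993, Definition 1.2.4] -/
theorem card_bridgeFin (N : ℕ) : #(bridgeFin N) = HexBW.bridgeCount N := by
  rw [HexBW.bridgeCount, ← image_toBW_bridgeFin,
    Finset.card_image_of_injOn ((toBW_injOn N).mono (Finset.coe_subset.2 (bridgeFin_subset N)))]


/-! ### The band of a bridge; windowed insertion slots and deletion sites -/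

/-- The height of the last vertex of a list (for `ω ∈ S_N(ℍ)`: `ht ω_N`). [cite: MadrasSlade1993, Definition 1.2.4] -/
def top (ω : List HV) : ℤ := htAt ω (ω.length - 1)

/-- `v` lies in the band `(0, A]` of heights. [cite: MadrasSlade1993, Definition 1.2.4] -/
def InBand (A : ℤ) (v : HV) : Prop := 0 < ht v ∧ ht v ≤ A

/-- `InBand A` is decidable (a conjunction of integer inequalities). [cite: MadrasSlade1993, Definition 1.2.4] -/
instance (A : ℤ) : DecidablePred (InBand A) := fun _ => instDecidableAnd

/-- **Admissible insertion slots of a bridge**: the hexagon slots whose three new vertices lie in the band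
`(0, ht ω_N]` (so that the inserted walk is again a bridge). `I_B(ω) := #(bSlots ω)`.
[cite: MadrasSlade1993, §7.3 (proof of Theorem 7.3.2), p. 244 (the pattern `U`)] -/
def bSlots (ω : List HV) : Finset (ℕ × HV × HV × HV) :=
  (hexSlots ω).filter fun s => InBand (top ω) s.2.1 ∧ InBand (top ω) s.2.2.1 ∧ InBand (top ω) s.2.2.2

/-- **Admissible deletion sites of a bridge**: the deletion sites `(m, v)` whose new vertex `v` lies in the
band `(0, ht ω_N]`. `J_B(ω) := #(bSharp ω)`. [cite: MadrasSlade1993, §7.3 (proof of Theorem 7.3.2), p. 244 (the pattern `V`)] -/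
def bSharp (ω : List HV) : Finset (ℕ × HV) := (hexSharp ω).filter fun p => InBand (top ω) p.2

/-- Membership in `bSlots`. [cite: MadrasSlade1993, §7.3] -/
theorem mem_bSlots {ω : List HV} {m : ℕ} {x y z : HV} : (m, x, y, z) ∈ bSlots ω ↔
    (m, x, y, z) ∈ hexSlots ω ∧ InBand (top ω) x ∧ InBand (top ω) y ∧ InBand (top ω) z := by
  rw [bSlots, mem_filter]

/-- Membership in `bSharp`. [cite: MadrasSlade1993, §7.3] -/
theorem mem_bSharp {ω : List HV} {m : ℕ} {v : HV} : (m, v) ∈ bSharp ω ↔ (m, v) ∈ hexSharp ω ∧ InBand (top ω) v := by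
  rw [bSharp, mem_filter]

/-- `bSlots ω ⊆ hexSlots ω`. [cite: MadrasSlade1993, §7.3] -/
theorem bSlots_subset (ω : List HV) : bSlots ω ⊆ hexSlots ω := filter_subset _ _

/-- `bSharp ω ⊆ hexSharp ω`. [cite: MadrasSlade1993, §7.3] -/
theorem bSharp_subset (ω : List HV) : bSharp ω ⊆ hexSharp ω := filter_subset _ _

/-- `I_B(ω) ≤ I(ω) ≤ 27(|ω| − 2)`. [cite: MadrasSlade1993, §7.3] -/
theorem card_bSlots_le (ω : List HV) : #(bSlots ω) ≤ 27 * (ω.length - 2) :=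
  (card_le_card (bSlots_subset ω)).trans card_hexSlots_le

/-- `J_B(ω) ≤ J(ω)`. [cite: MadrasSlade1993, §7.3] -/
theorem card_bSharp_le (ω : List HV) : #(bSharp ω) ≤ #(hexSharp ω) := card_le_card (bSharp_subset ω)

section Band

variable {N : ℕ} {ω : List HV} {m : ℕ} {x y z v : HV}

/-- For `ω ∈ S_N(ℍ)`, `top ω = ht ω_N`. [cite: MadrasSlade1993, Definition 1.2.4] -/
theorem top_eq (hω : ω ∈ sawFin hvOrigin N) : top ω = htAt ω N := by
  rw [top, length_of_mem_sawFin hω, Nat.add_sub_cancel]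

/-- For `ω ∈ S_N(ℍ)`, `ht ω_0 = 0`. [cite: MadrasSlade1993, §1.1] -/
theorem htAt_zero (hω : ω ∈ sawFin hvOrigin N) : htAt ω 0 = 0 := by
  rw [htAt, getD_zero_of_mem_sawFin hω, ht_hvOrigin]

/-- The interior and final vertices of a bridge lie in its band. [cite: MadrasSlade1993, Definition 1.2.4] -/
theorem inBand_of_mem_bridgeFin (hω : ω ∈ bridgeFin N) {i : ℕ} (h1 : 1 ≤ i) (h2 : i ≤ N) :
    InBand (top ω) (ω.getD i hvOrigin) := by
  obtain ⟨hωS, hb⟩ := mem_bridgeFin.1 hω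
  have h := hb i h1 h2
  rw [htAt_zero hωS] at h
  rw [top_eq hωS]
  exact h

/-- Insertion does not move the last vertex: `top (hexIns m x y z ω) = top ω`. [cite: MadrasSlade1993, §7.3] -/
theorem top_hexIns (hω : ω ∈ sawFin hvOrigin N) (hs : (m, x, y, z) ∈ hexSlots ω) :
    top (hexIns m x y z ω) = top ω := by
  obtain ⟨hm, -⟩ := mem_hexSlots.1 hs
  have hl := length_of_mem_sawFin hω
  rw [top, top, htAt, htAt, length_hexIns (by omega), hl, show N + 1 + 2 - 1 = N + 2 by omega,
    Nat.add_sub_cancel, getD_hexIns_of_ge (by omega) (by omega), show N + 2 - 2 = N by omega]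

/-- Deletion does not move the last vertex: `top (hexDel m v ω) = top ω`. [cite: MadrasSlade1993, §7.3] -/
theorem top_hexDel (hω : ω ∈ sawFin hvOrigin (N + 2)) (hm : (m, v) ∈ hexSharp ω) :
    top (hexDel m v ω) = top ω := by
  obtain ⟨hml, -⟩ := mem_hexSharp.1 hm
  have hl := length_of_mem_sawFin hω
  rw [top, top, htAt, htAt, length_hexDel (by omega), hl, show N + 2 + 1 - 2 - 1 = N by omega,
    show N + 2 + 1 - 1 = N + 2 by omega, getD_hexDel_of_ge (by omega) (by omega)]

/-- **Insertion at an admissible slot of a bridge gives a bridge.** [cite: MadrasSlade1993, §7.3 (proof of Theorem 7.3.2)] -/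
theorem hexIns_mem_bridgeFin (hω : ω ∈ bridgeFin N) (hs : (m, x, y, z) ∈ bSlots ω) :
    hexIns m x y z ω ∈ bridgeFin (N + 2) := by
  obtain ⟨hωS, hb⟩ := mem_bridgeFin.1 hω
  obtain ⟨hs0, hx, hy, hz⟩ := mem_bSlots.1 hs
  obtain ⟨hm, -⟩ := mem_hexSlots.1 hs0
  have hl := length_of_mem_sawFin hωS
  have hS' := hexIns_mem_sawFin hωS hs0
  have h0 : htAt (hexIns m x y z ω) 0 = 0 := htAt_zero hS'
  have hN : htAt (hexIns m x y z ω) (N + 2) = htAt ω N := by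
    rw [htAt, htAt, getD_hexIns_of_ge (by omega) (by omega), show N + 2 - 2 = N by omega]
  have htop : top ω = htAt ω N := top_eq hωS
  have hω0 : htAt ω 0 = 0 := htAt_zero hωS
  refine mem_bridgeFin.2 ⟨hS', fun i h1 h2 => ?_⟩
  rw [h0, hN]
  rcases Nat.lt_or_ge i (m + 1) with hi | hi
  · -- prefix
    have e : htAt (hexIns m x y z ω) i = htAt ω i := by rw [htAt, htAt, getD_hexIns_of_le (by omega) (by omega)]
    rw [e]
    have := hb i h1 (by omega)
    rwa [hω0] at this
  rcases Nat.lt_or_ge i (m + 4) with hi' | hi'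
  · -- the three new vertices
    have e : htAt (hexIns m x y z ω) i = ht x ∨ htAt (hexIns m x y z ω) i = ht y ∨
        htAt (hexIns m x y z ω) i = ht z := by
      rcases (by omega : i = m + 1 ∨ i = m + 2 ∨ i = m + 3) with rfl | rfl | rfl
      · left; rw [htAt, getD_hexIns_one (by omega)]
      · right; left; rw [htAt, getD_hexIns_two (by omega)]
      · right; right; rw [htAt, getD_hexIns_three (by omega)]
    rw [htop] at hx hy hz
    rcases e with e | e | e <;> rw [e]
    · exact hx
    · exact hy
    · exact hz
  · -- suffix, shifted by two
    have e : htAt (hexIns m x y z ω) i = htAt ω (i - 2) := by rw [htAt, htAt, getD_hexIns_of_ge (by omega) hi']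
    rw [e]
    have := hb (i - 2) (by omega) (by omega)
    rwa [hω0] at this

/-- **Deletion at an admissible site of a bridge gives a bridge.** [cite: MadrasSlade1993, §7.3 (proof of Theorem 7.3.2)] -/
theorem hexDel_mem_bridgeFin (hω : ω ∈ bridgeFin (N + 2)) (hp : (m, v) ∈ bSharp ω) :
    hexDel m v ω ∈ bridgeFin N := by
  obtain ⟨hωS, hb⟩ := mem_bridgeFin.1 hω
  obtain ⟨hp0, hv⟩ := mem_bSharp.1 hp
  obtain ⟨hml, -⟩ := mem_hexSharp.1 hp0
  have hl := length_of_mem_sawFin hωS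
  have hS' := hexDel_mem_sawFin hωS hp0
  have h0 : htAt (hexDel m v ω) 0 = 0 := htAt_zero hS'
  have hN : htAt (hexDel m v ω) N = htAt ω (N + 2) := by
    rw [htAt, htAt, getD_hexDel_of_ge (by omega) (by omega)]
  have htop : top ω = htAt ω (N + 2) := top_eq hωS
  have hω0 : htAt ω 0 = 0 := htAt_zero hωS
  refine mem_bridgeFin.2 ⟨hS', fun i h1 h2 => ?_⟩
  rw [h0, hN]
  rcases Nat.lt_or_ge i (m + 1) with hi | hi
  · have e : htAt (hexDel m v ω) i = htAt ω i := by rw [htAt, htAt, getD_hexDel_of_le (by omega) (by omega)]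
    rw [e]
    have := hb i h1 (by omega)
    rwa [hω0] at this
  rcases Nat.lt_or_ge i (m + 2) with hi' | hi'
  · have e : htAt (hexDel m v ω) i = ht v := by
      rw [show i = m + 1 by omega, htAt, getD_hexDel_one (by omega)]
    rw [e]
    rw [htop] at hv
    exact hv
  · have e : htAt (hexDel m v ω) i = htAt ω (i + 2) := by rw [htAt, htAt, getD_hexDel_of_ge (by omega) hi']
    rw [e]
    have := hb (i + 2) (by omega) (by omega)
    rwa [hω0] at this

/-- After an admissible insertion into a bridge, the removed vertex `ω_{m+1}` marks an ADMISSIBLE deletion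
site of the new bridge. [cite: MadrasSlade1993, §7.3 (proof of Theorem 7.3.2)] -/
theorem mem_bSharp_hexIns (hω : ω ∈ bridgeFin N) (hs : (m, x, y, z) ∈ bSlots ω) :
    (m, ω.getD (m + 1) hvOrigin) ∈ bSharp (hexIns m x y z ω) := by
  obtain ⟨hωS, -⟩ := mem_bridgeFin.1 hω
  have hs0 := bSlots_subset ω hs
  obtain ⟨hm, -⟩ := mem_hexSlots.1 hs0
  have hl := length_of_mem_sawFin hωS
  refine mem_bSharp.2 ⟨mem_hexSharp_hexIns hωS hs0, ?_⟩
  rw [top_hexIns hωS hs0]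
  exact inBand_of_mem_bridgeFin hω (by omega) (by omega)

/-- After an admissible deletion from a bridge, the three removed vertices form an ADMISSIBLE insertion slot
of the new bridge. [cite: MadrasSlade1993, §7.3 (proof of Theorem 7.3.2)] -/
theorem mem_bSlots_hexDel (hω : ω ∈ bridgeFin (N + 2)) (hp : (m, v) ∈ bSharp ω) :
    (m, ω.getD (m + 1) hvOrigin, ω.getD (m + 2) hvOrigin, ω.getD (m + 3) hvOrigin) ∈ bSlots (hexDel m v ω) := by
  obtain ⟨hωS, -⟩ := mem_bridgeFin.1 hω
  have hp0 := bSharp_subset ω hp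
  obtain ⟨hml, -⟩ := mem_hexSharp.1 hp0
  have hl := length_of_mem_sawFin hωS
  refine mem_bSlots.2 ⟨mem_hexSlots_hexDel hωS hp0, ?_, ?_, ?_⟩ <;> rw [top_hexDel hωS hp0]
  · exact inBand_of_mem_bridgeFin hω (by omega) (by omega)
  · exact inBand_of_mem_bridgeFin hω (by omega) (by omega)
  · exact inBand_of_mem_bridgeFin hω (by omega) (by omega)

end Band

/-! ### Counting the admissible pairs in two ways (Madras–Slade (7.3.5)–(7.3.6), restricted to bridges) -/

section Pairs

/-- The admissible slot pairs `(ω, s)`, `ω ∈ B_N(ℍ)`, `s ∈ bSlots ω`. [cite: MadrasSlade1993, §7.3 (proof of Theorem 7.3.2), (7.3.5)] -/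
def bSlotPairs (N : ℕ) : Finset (Σ _ : List HV, ℕ × HV × HV × HV) := (bridgeFin N).sigma fun ω => bSlots ω

/-- The admissible deletion-site pairs `(ω, (m, v))`, `ω ∈ B_N(ℍ)`. [cite: MadrasSlade1993, §7.3 (proof of Theorem 7.3.2), (7.3.5)] -/
def bSharpPairs (N : ℕ) : Finset (Σ _ : List HV, ℕ × HV) := (bridgeFin N).sigma fun ω => bSharp ω

/-- Summing over admissible slot pairs is summing `I_B(ω) · F(ω)` over bridges. [cite: MadrasSlade1993, §7.3 (proof of Theorem 7.3.2)] -/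
theorem sum_bSlotPairs (N : ℕ) (F : List HV → ℝ) :
    ∑ p ∈ bSlotPairs N, F p.1 = ∑ ω ∈ bridgeFin N, (#(bSlots ω) : ℝ) * F ω := by
  rw [bSlotPairs, Finset.sum_sigma]
  refine sum_congr rfl fun ω _ => ?_
  change ∑ s ∈ bSlots ω, F ω = _
  rw [sum_const, nsmul_eq_mul]

/-- Summing over admissible deletion-site pairs is summing `J_B(ω) · F(ω)` over bridges.
[cite: MadrasSlade1993, §7.3 (proof of Theorem 7.3.2)] -/
theorem sum_bSharpPairs (N : ℕ) (F : List HV → ℝ) :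
    ∑ q ∈ bSharpPairs N, F q.1 = ∑ ω ∈ bridgeFin N, (#(bSharp ω) : ℝ) * F ω := by
  rw [bSharpPairs, Finset.sum_sigma]
  refine sum_congr rfl fun ω _ => ?_
  change ∑ s ∈ bSharp ω, F ω = _
  rw [sum_const, nsmul_eq_mul]

/-- **Counting the admissible pairs in two ways**: `(ω, (m, x, y, z)) ↦ (hexIns m x y z ω, (m, ω_{m+1}))` is a
bijection from the admissible slot pairs of `B_N(ℍ)` onto the admissible deletion-site pairs of `B_{N+2}(ℍ)`.
[cite: MadrasSlade1993, §7.3 (proof of Theorem 7.3.2), (7.3.5)–(7.3.6)] -/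
theorem sum_bSlotPairs_eq_sum_bSharpPairs (N : ℕ) (F : (Σ _ : List HV, ℕ × HV × HV × HV) → ℝ)
    (G : (Σ _ : List HV, ℕ × HV) → ℝ)
    (h : ∀ p ∈ bSlotPairs N,
      F p = G ⟨hexIns p.2.1 p.2.2.1 p.2.2.2.1 p.2.2.2.2 p.1, (p.2.1, p.1.getD (p.2.1 + 1) hvOrigin)⟩) :
    ∑ p ∈ bSlotPairs N, F p = ∑ q ∈ bSharpPairs (N + 2), G q := by
  refine Finset.sum_nbij' (fun p => ⟨hexIns p.2.1 p.2.2.1 p.2.2.2.1 p.2.2.2.2 p.1, (p.2.1, p.1.getD (p.2.1 + 1) hvOrigin)⟩)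
    (fun q => ⟨hexDel q.2.1 q.2.2 q.1,
      (q.2.1, q.1.getD (q.2.1 + 1) hvOrigin, q.1.getD (q.2.1 + 2) hvOrigin, q.1.getD (q.2.1 + 3) hvOrigin)⟩)
    ?_ ?_ ?_ ?_ h
  · rintro ⟨ω, m, x, y, z⟩ hp
    rw [bSlotPairs, Finset.mem_sigma] at hp
    rw [bSharpPairs, Finset.mem_sigma]
    exact ⟨hexIns_mem_bridgeFin hp.1 hp.2, mem_bSharp_hexIns hp.1 hp.2⟩
  · rintro ⟨ω, m, v⟩ hq
    rw [bSharpPairs, Finset.mem_sigma] at hq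
    rw [bSlotPairs, Finset.mem_sigma]
    exact ⟨hexDel_mem_bridgeFin hq.1 hq.2, mem_bSlots_hexDel hq.1 hq.2⟩
  · rintro ⟨ω, m, x, y, z⟩ hp
    rw [bSlotPairs, Finset.mem_sigma] at hp
    dsimp only at hp
    obtain ⟨hm, -⟩ := mem_hexSlots.1 (bSlots_subset _ hp.2)
    dsimp only
    rw [hexDel_hexIns (by omega), getD_hexIns_one (by omega), getD_hexIns_two (by omega),
      getD_hexIns_three (by omega)]
  · rintro ⟨ω, m, v⟩ hq
    rw [bSharpPairs, Finset.mem_sigma] at hq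
    dsimp only at hq
    obtain ⟨hml, -⟩ := mem_hexSharp.1 (bSharp_subset _ hq.2)
    dsimp only
    rw [hexIns_hexDel (by omega), getD_hexDel_one (by omega)]

end Pairs

end Literature.Probability.RandomPlanarGeometry.SAW.HV
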